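import Literature.Probability.RandomPlanarGeometry.HexSAWSurfaceWallRenewalThirdLower
import HarnessLib

/-!
# The census at half-length four is exact: the flat excursion is the ONLY irreducible renewal block of length eight —
# `N₄₁ = #(ipwb 8) = 1`, `Λ₈(y) = y`, `f₄(y) = y/β(y)⁸`

Topic `Literature/Probability/RandomPlanarGeometry` (lane «pcv-sawmu», a-idea-1 g30, car «EIGHT-UNIQUE»; parent: the pool car
«THIRD-LOWER-MEAN» `HexSAWSurfaceWallRenewalThirdLower.lean` (`fw_mem_ipwb : Eight.fw ∈ ipwb 8`, `one_le_card_ipwb_eight`), through it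
«EXCESS-LIMIT» (`visits_eq_one_of_mem_ipwb_eight`: every irreducible positive wall bridge of length eight has ONE visit; `IPWB_eight`,
`pwbLaw_four`) and the tree (`HexSAWSurfaceWallRenewal`: `pwb`, `ipwb`, `Arm.step_cases`; `HexSAWSurfaceSqrtAsymptotic`: `surface_next_step`;
`HexSAWBrickWallWalks`: `parity_apply`, `Arm.eq_of_agree`; `HexSAWSurfaceSecondOrderSharp` §8: the length-SIX classification
`one_visit_six_coords` / `wbrN_six_one`, whose method this file repeats one length up)).

Sources (primary; identifiers verbatim, no quotation marks).  N. Madras, G. Slade, *The Self-Avoiding Walk*, Birkhäuser 1993: Section 1.2,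
Definition 1.2.4 (bridges) and Section 4.2, Definition 4.2.1, (4.2.2)–(4.2.4) (p. 91).  H. Kesten, J. Math. Phys. 4 (1963) 960, Section 4.
I. G. Enting, I. Jensen, LNP 775 (2009), Section 7.4.2, Fig. 7.10 (brickwork form of the honeycomb lattice: vertical bonds alternate).
E. J. Janse van Rensburg, *The Statistical Mechanics of Interacting Walks, Polygons, Animals and Vesicles*, OUP 2000, Section 3.3.2, Lemma 3.20.
N. R. Beaton, M. Bousquet-Mélou, J. de Gier, H. Duminil-Copin, A. J. Guttmann, CMP 326 (2014) = arXiv:1109.0358v5, Section 3.1 (p. 8: contacts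
with the surface).

## What is proved (namespace `…SAW.HexBW.Wall`; lengths symbolic, `{m} (hm : m = 8)`)

* §1 ★★ `one_visit_pwb_eight_coords (hω : ω ∈ pwb 8) (visits 8 ω = 1)` : the coordinates are FORCED —
  `(1,0) (1,−1) (2,−1) (3,−1) (4,−1) (5,−1) (5,0) (6,0)`.  Case analysis on the brick-wall steps (`Arm.step_cases`): after the forced
  `(1,0)(1,−1)(2,−1)` (no visit at time 2; positivity kills `(0,−1)`; the vertical bond below `(1,−1)` is absent), time 4 is `(3,−1)` or
  `(2,−2)`; from `(2,−2)` the surface cannot be regained by time 8 (the vertical bonds at `(3,−2)`, `(1,−2)↑`, `(4,−1)↑` are absent /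
  positivity); from `(3,−1)` the branch `(3,0)` dies at time 7 (`(4,0)` would be a visit at time 6, `(2,0)` is boxed in), the branch
  `(4,−1)(4,−2)` cannot regain the surface, `(4,−1)(5,−1)(6,−1)` neither (no bond `(6,−1)↑`), and `(4,−1)(5,−1)(5,0)(4,0)` violates the
  bridge condition `X₆ ≤ X₈`; what is left is the flat excursion.
* §2 ★★ `card_ipwb_eight_le_one`, ★★★ **`card_ipwb_eight_eq_one : #(ipwb 8) = 1`** (`N₄₁ = 1`: with «THIRD-LOWER-MEAN»'s `fw_mem_ipwb`),
  ★★ `IPWB_eight_eq : Λ₈(y) = y`, ★★ `pwbLaw_four_eq : f₄(y) = y/β(y)⁸` — the renewal law is now EXPLICIT through half-length four: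
  `f₁ = y/β², f₂ = 0, f₃ = y/β⁶, f₄ = y/β⁸`; `card_oneVisit_pwb_eight_eq_one : #{ω ∈ pwb 8 | one visit} = 1`.
* §3 `two_three_eq_le_pwbMean_sub_one : 2y/β⁶ + 3y/β⁸ + 4f₅ ≤ m − 1` restated with the exact `f₄`, and
  `pwbMean_sub_one_sub_sub_nonneg : 0 ≤ m − 1 − 2y/β⁶ − 3y/β⁸`.

NOT claimed: `N₅₂`, `N₆₃` (the two- and three-visit irreducible blocks of lengths 10, 12 — hooks), hence not the third-order coefficient
`3 + 4N₅₂ + 5N₆₃` of `m − 1`; `wbrN 8 1 = 1` for GENERAL (not necessarily positive) wall bridges is not needed and not proved; `y ≤ μ⁴`.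
-/

namespace Literature.Probability.RandomPlanarGeometry.SAW.HexBW.Wall

open Finset Filter Function
open Literature.Probability.LatticeModels
open _root_.Topology

variable {y : ℝ} {n : ℕ} {ω : ℕ → Site 2}

/-! ### §1  Anatomy of a one-visit positive wall bridge of length eight -/

/-- ★★ **A one-visit positive wall bridge of length eight is the flat excursion** `(0,0)(1,0)(1,−1)(2,−1)(3,−1)(4,−1)(5,−1)(5,0)(6,0)`
(symbolic length `m = 8`; no hypothesis with a closed index is ever introduced). [cite: EntingJensen2009, Section 7.4.2, Fig. 7.10] [cite: MadrasSlade1993, Section 1.2, Definition 1.2.4] [cite: JansevanRensburg2000, Section 3.3.2, Lemma 3.20] -/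
theorem one_visit_pwb_eight_coords {m : ℕ} (hm : m = 8) (hω : ω ∈ pwb m) (hv : visits m ω = 1) :
    (ω 1 0 = 1 ∧ ω 1 1 = 0) ∧ (ω 2 0 = 1 ∧ ω 2 1 = -1) ∧ (ω 3 0 = 2 ∧ ω 3 1 = -1) ∧ (ω 4 0 = 3 ∧ ω 4 1 = -1) ∧
      (ω 5 0 = 4 ∧ ω 5 1 = -1) ∧ (ω 6 0 = 5 ∧ ω 6 1 = -1) ∧ (ω 7 0 = 5 ∧ ω 7 1 = 0) ∧ (ω 8 0 = 6 ∧ ω 8 1 = 0) := by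
  obtain ⟨hωw, hbr⟩ := mem_pwb.1 hω
  obtain ⟨hωa, -⟩ := mem_wbr.1 hωw
  obtain ⟨hωh, -, hend⟩ := mem_archs.1 hωa
  obtain ⟨hωs, hH⟩ := mem_hpw.1 hωh
  obtain ⟨h0, -, hbw, hinj⟩ := mem_saws_iff.1 hωs
  -- (`m` is NEVER substituted: a hypothesis with a closed index such as `ω ∈ pwb 8` would be `whnf`ed into an enumeration)
  have hne : ∀ a b : ℕ, a ≤ 8 → b ≤ 8 → a ≠ b → ¬ (ω a 0 = ω b 0 ∧ ω a 1 = ω b 1) := by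
    intro a b ha hb hab h
    have := hinj (show a ∈ {i | i ≤ m} by simp only [Set.mem_setOf_eq]; omega)
      (show b ∈ {i | i ≤ m} by simp only [Set.mem_setOf_eq]; omega) ((site_two_eq_iff _ _).2 h)
    exact hab this
  have h00 : ω 0 0 = 0 := by rw [h0]; rfl
  have h01 : ω 0 1 = 0 := by rw [h0]; rfl
  have hend8 : ω 8 1 = 0 := by have h := hend; rwa [hm] at h
  -- positivity and the bridge condition
  have hpos : ∀ i, 1 ≤ i → i ≤ 8 → 0 < ω i 0 := fun i h1 h2 => by
    have h := (hbr i h1 (by omega)).1; rwa [h00] at h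
  have hle8 : ∀ i, 1 ≤ i → i ≤ 8 → ω i 0 ≤ ω 8 0 := fun i h1 h2 => by
    have h := (hbr i h1 (by omega)).2; rwa [hm] at h
  -- one visit: times 2, 4, 6 are off the row
  have hv8 : visits 8 ω = 1 := by have h := hv; rwa [hm] at h
  have e : visits 8 ω = (if ω 2 1 = 0 then 1 else 0) + (if ω 4 1 = 0 then 1 else 0) + (if ω 6 1 = 0 then 1 else 0) +
      (if ω 8 1 = 0 then 1 else 0) := by
    simp [visits]
  rw [hv8, if_pos hend8] at e
  have hn : ¬ (ω 2 1 = 0) ∧ ¬ (ω 4 1 = 0) ∧ ¬ (ω 6 1 = 0) := by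
    by_cases h2 : ω 2 1 = 0 <;> by_cases h4 : ω 4 1 = 0 <;> by_cases h6 : ω 6 1 = 0 <;>
      simp only [h2, h4, h6, if_true, if_false] at e <;> first | exact ⟨h2, h4, h6⟩ | (exfalso; omega)
  obtain ⟨hn2, hn4, hn6⟩ := hn
  -- heights are ≤ 0
  have hH2 := hH 2 (by omega)
  have hH6 := hH 6 (by omega)
  have hH7 := hH 7 (by omega)
  -- time 1: `(1, 0)`
  obtain ⟨hY1, hX1⟩ := surface_next_step hωh (i := 0) (by omega) (by omega) h01
  rw [show 0 + 1 = 1 from rfl] at hY1 hX1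
  have hp1 := hpos 1 (by omega) (by omega)
  have hX1' : ω 1 0 = 1 := by omega
  clear hX1
  -- time 2: `(1, −1)`
  have s1 := Arm.step_cases (hbw 1 (by omega))
  rw [show 1 + 1 = 2 from rfl] at s1
  have hX2 : ω 2 0 = 1 ∧ ω 2 1 = -1 := by constructor <;> omega
  clear s1
  obtain ⟨hX2, hY2⟩ := hX2
  -- time 3: `(2, −1)` (positivity kills `(0,−1)`, injectivity kills `(1,0)`, the bond below `(1,−1)` is absent)
  have s2 := Arm.step_cases (hbw 2 (by omega))
  rw [show 2 + 1 = 3 from rfl] at s2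
  have hp3 := hpos 3 (by omega) (by omega)
  have h31 := hne 3 1 (by omega) (by omega) (by omega)
  have hX3 : ω 3 0 = 2 ∧ ω 3 1 = -1 := by constructor <;> omega
  clear s2 h31 hp3
  obtain ⟨hX3, hY3⟩ := hX3
  -- time 4: `(3, −1)` or `(2, −2)`
  have s3 := Arm.step_cases (hbw 3 (by omega))
  rw [show 3 + 1 = 4 from rfl] at s3
  have h42 := hne 4 2 (by omega) (by omega) (by omega)
  have h4 : (ω 4 0 = 3 ∧ ω 4 1 = -1) ∨ (ω 4 0 = 2 ∧ ω 4 1 = -2) := by omega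
  clear s3 h42
  have s4 := Arm.step_cases (hbw 4 (by omega))
  rw [show 4 + 1 = 5 from rfl] at s4
  have s5 := Arm.step_cases (hbw 5 (by omega))
  rw [show 5 + 1 = 6 from rfl] at s5
  have s6 := Arm.step_cases (hbw 6 (by omega))
  rw [show 6 + 1 = 7 from rfl] at s6
  have s7 := Arm.step_cases (hbw 7 (by omega))
  rw [show 7 + 1 = 8 from rfl] at s7
  have h53 := hne 5 3 (by omega) (by omega) (by omega)
  have h64 := hne 6 4 (by omega) (by omega) (by omega)
  have h75 := hne 7 5 (by omega) (by omega) (by omega)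
  rcases h4 with ⟨hX4, hY4⟩ | ⟨hX4, hY4⟩
  swap
  · -- the deep branch `(2,−2)`: the surface cannot be regained by time 8
    exfalso
    have hp6 := hpos 6 (by omega) (by omega)
    have h5 : ω 5 1 = -2 ∧ (ω 5 0 = 3 ∨ ω 5 0 = 1) := by clear s5 s6 s7 h64 h75 hp6; constructor <;> omega
    clear s4 h53
    obtain ⟨hY5, hX5⟩ := h5
    rcases hX5 with hX5 | hX5
    · -- `(3,−2)`: no vertical bond up; then `(4,−2)(4,−1)` has no bond up at time 8, everything else stays at depth ≤ −2
      have h6 : (ω 6 0 = 4 ∧ ω 6 1 = -2) ∨ ω 6 1 = -3 := by clear s6 s7 h75 hp6; omega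
      clear s5 h64
      rcases h6 with ⟨hX6, hY6⟩ | hY6
      · omega
      · clear h75; omega
    · -- `(1,−2)`: positivity kills `(0,−2)`, injectivity kills `(2,−2)`, no bond up; `(1,−3)` is too deep
      have hY6 : ω 6 1 = -3 := by clear s6 s7 h75; omega
      clear s5 h64 h75 hp6
      omega
  · -- the flat branch `(3,−1)`: time 5 is `(4,−1)` or `(3,0)`
    have h5 : (ω 5 0 = 4 ∧ ω 5 1 = -1) ∨ (ω 5 0 = 3 ∧ ω 5 1 = 0) := by clear s5 s6 s7 h64 h75; omega
    clear s4 h53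
    rcases h5 with ⟨hX5, hY5⟩ | ⟨hX5, hY5⟩
    swap
    · -- `(3,0)`: `(4,0)` would be a visit at time 6, `(3,−1)` is taken, so time 6 is `(2,0)` — boxed in at time 7
      exfalso
      have h71 := hne 7 1 (by omega) (by omega) (by omega)
      have h6 : ω 6 0 = 2 ∧ ω 6 1 = 0 := by clear s6 s7 h75 h71; constructor <;> omega
      clear s5 h64
      obtain ⟨hX6, hY6⟩ := h6
      omega
    · -- `(4,−1)`: time 6 is `(5,−1)` or `(4,−2)`
      have h6 : (ω 6 0 = 5 ∧ ω 6 1 = -1) ∨ (ω 6 0 = 4 ∧ ω 6 1 = -2) := by clear s6 s7 h75; omega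
      clear s5 h64
      rcases h6 with ⟨hX6, hY6⟩ | ⟨hX6, hY6⟩
      swap
      · -- `(4,−2)`: cannot regain the surface by time 8
        exfalso
        omega
      · -- `(5,−1)`: time 7 is `(5,0)` (the branch `(6,−1)` has no bond up), time 8 is `(6,0)` (`(4,0)` breaks `X₆ ≤ X₈`)
        have hle6 := hle8 6 (by omega) (by omega)
        have h7 : ω 7 0 = 5 ∧ ω 7 1 = 0 := by clear hle6; constructor <;> omega
        clear s6 h75
        obtain ⟨hX7, hY7⟩ := h7
        have hX8 : ω 8 0 = 6 := by omega
        exact ⟨⟨hX1', hY1⟩, ⟨hX2, hY2⟩, ⟨hX3, hY3⟩, ⟨hX4, hY4⟩, ⟨hX5, hY5⟩, ⟨hX6, hY6⟩, ⟨hX7, hY7⟩, ⟨hX8, hend8⟩⟩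

/-! ### §2  `N₄₁ = 1`, `Λ₈ = y`, `f₄ = y/β⁸` -/

open Classical in
/-- ★★ **At most one** one-visit positive wall bridge of length eight (symbolic length). [cite: JansevanRensburg2000, Section 3.3.2, Lemma 3.20] [cite: EntingJensen2009, Section 7.4.2, Fig. 7.10] -/
theorem card_oneVisit_pwb_eight_le_one {m : ℕ} (hm : m = 8) : #((pwb m).filter fun ω => visits m ω = 1) ≤ 1 := by
  refine Finset.card_le_one.2 fun ω hω ω' hω' => ?_
  obtain ⟨hωp, hv⟩ := Finset.mem_filter.1 hω
  obtain ⟨hωp', hv'⟩ := Finset.mem_filter.1 hω'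
  have hc := one_visit_pwb_eight_coords hm hωp hv
  have hc' := one_visit_pwb_eight_coords hm hωp' hv'
  have hωs : ω ∈ saws m := saws_of_mem_pwb hωp
  have hωs' : ω' ∈ saws m := saws_of_mem_pwb hωp'
  obtain ⟨h0, -, -, -⟩ := mem_saws_iff.1 hωs
  obtain ⟨h0', -, -, -⟩ := mem_saws_iff.1 hωs'
  obtain ⟨⟨a0, a1⟩, ⟨b0, b1⟩, ⟨c0, c1⟩, ⟨d0, d1⟩, ⟨e0, e1⟩, ⟨f0, f1⟩, ⟨g0, g1⟩, ⟨i0, i1⟩⟩ := hc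
  obtain ⟨⟨a0', a1'⟩, ⟨b0', b1'⟩, ⟨c0', c1'⟩, ⟨d0', d1'⟩, ⟨e0', e1'⟩, ⟨f0', f1'⟩, ⟨g0', g1'⟩, ⟨i0', i1'⟩⟩ := hc'
  refine Arm.eq_of_agree hωs hωs' fun i hi => ?_
  have hcase : i = 0 ∨ i = 1 ∨ i = 2 ∨ i = 3 ∨ i = 4 ∨ i = 5 ∨ i = 6 ∨ i = 7 ∨ i = 8 := by omega
  rcases hcase with rfl | rfl | rfl | rfl | rfl | rfl | rfl | rfl | rfl
  · rw [h0, h0']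
  · exact (site_two_eq_iff _ _).2 ⟨by rw [a0, a0'], by rw [a1, a1']⟩
  · exact (site_two_eq_iff _ _).2 ⟨by rw [b0, b0'], by rw [b1, b1']⟩
  · exact (site_two_eq_iff _ _).2 ⟨by rw [c0, c0'], by rw [c1, c1']⟩
  · exact (site_two_eq_iff _ _).2 ⟨by rw [d0, d0'], by rw [d1, d1']⟩
  · exact (site_two_eq_iff _ _).2 ⟨by rw [e0, e0'], by rw [e1, e1']⟩
  · exact (site_two_eq_iff _ _).2 ⟨by rw [f0, f0'], by rw [f1, f1']⟩
  · exact (site_two_eq_iff _ _).2 ⟨by rw [g0, g0'], by rw [g1, g1']⟩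
  · exact (site_two_eq_iff _ _).2 ⟨by rw [i0, i0'], by rw [i1, i1']⟩

open Classical in
/-- ★★ `#(ipwb 8) ≤ 1`: an irreducible positive wall bridge of length eight has one visit («EXCESS-LIMIT») and is positive, so it is
the flat excursion (symbolic length). [cite: MadrasSlade1993, Section 4.2, Definition 4.2.1] [cite: Kesten1963SAW, Section 4] -/
theorem card_ipwb_eight_le_one {m : ℕ} (hm : m = 8) : #(ipwb m) ≤ 1 :=
  (Finset.card_le_card fun _ hω => Finset.mem_filter.2 ⟨ipwb_subset hω, visits_eq_one_of_mem_ipwb_eight hm hω⟩).trans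
    (card_oneVisit_pwb_eight_le_one hm)

/-- ★★★ **`N₄₁ = #(ipwb 8) = 1`**: the flat excursion is THE irreducible renewal block of length eight (symbolic length).
[cite: MadrasSlade1993, Section 4.2, Definition 4.2.1, (4.2.2)] [cite: Kesten1963SAW, Section 4] [cite: EntingJensen2009, Section 7.4.2, Fig. 7.10] -/
theorem card_ipwb_eight_eq_one {m : ℕ} (hm : m = 8) : #(ipwb m) = 1 :=
  le_antisymm (card_ipwb_eight_le_one hm) (one_le_card_ipwb_eight hm)

open Classical in
/-- `#{ω ∈ pwb 8 | one visit} = 1` (symbolic length). [cite: JansevanRensburg2000, Section 3.3.2, Lemma 3.20] -/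
theorem card_oneVisit_pwb_eight_eq_one {m : ℕ} (hm : m = 8) : #((pwb m).filter fun ω => visits m ω = 1) = 1 := by
  refine le_antisymm (card_oneVisit_pwb_eight_le_one hm) ?_
  have h1 : 1 ≤ #(ipwb m) := one_le_card_ipwb_eight hm
  exact h1.trans (Finset.card_le_card fun _ hω =>
    Finset.mem_filter.2 ⟨ipwb_subset hω, visits_eq_one_of_mem_ipwb_eight hm hω⟩)

/-- ★★ **`Λ₈(y) = y`** (symbolic length). [cite: MadrasSlade1993, Section 4.2, (4.2.2)] -/
theorem IPWB_eight_eq {m : ℕ} (hm : m = 8) (y : ℝ) : IPWB m y = y := by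
  rw [IPWB_eight hm, card_ipwb_eight_eq_one hm, Nat.cast_one, one_mul]

/-- ★★ **`f₄(y) = y/β(y)⁸`**: with `f₁ = y/β²`, `f₂ = 0`, `f₃ = y/β⁶` the renewal law is explicit through half-length four.
[cite: MadrasSlade1993, Section 4.2, (4.2.2), (4.2.4)] [cite: Kesten1963SAW, Section 4] -/
theorem pwbLaw_four_eq (y : ℝ) : pwbLaw y 4 = y / wallRate y ^ 8 := by
  have key : ∀ m, m = 8 → pwbLaw y 4 = y / wallRate y ^ 8 := by
    intro m hm
    rw [pwbLaw_four hm, card_ipwb_eight_eq_one hm, Nat.cast_one, one_mul]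
  exact key 8 rfl

/-! ### §3  The head of the renewal mean with the exact fourth term -/

/-- `2y/β⁶ + 3y/β⁸ + 4f₅(y) ≤ m(y) − 1` (`y > μ⁴`): «EXCESS-LIMIT»'s head bound with `f₃`, `f₄` explicit.
[cite: MadrasSlade1993, Section 4.2, (4.2.2)-(4.2.5) (p. 91)] -/
theorem two_three_eq_le_pwbMean_sub_one (hy : hexConnectiveConstant ^ 4 < y) :
    2 * (y / wallRate y ^ 6) + 3 * (y / wallRate y ^ 8) + 4 * pwbLaw y 5 ≤ pwbMean y - 1 := by
  have h := two_three_four_le_pwbMean_sub_one hy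
  rw [pwbLaw_three, pwbLaw_four_eq] at h
  exact h

/-- `0 ≤ m(y) − 1 − 2y/β⁶ − 3y/β⁸` (`y > μ⁴`). [cite: MadrasSlade1993, Section 4.2, (4.2.5) (p. 91)] -/
theorem pwbMean_sub_one_sub_sub_nonneg (hy : hexConnectiveConstant ^ 4 < y) :
    0 ≤ pwbMean y - 1 - 2 * y / wallRate y ^ 6 - 3 * y / wallRate y ^ 8 := by
  have h := two_mul_add_three_mul_le_pwbMean_sub_one hy
  have e : pwbMean y - 1 - 2 * y / wallRate y ^ 6 - 3 * y / wallRate y ^ 8 =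
      pwbMean y - 1 - (2 * (y / wallRate y ^ 6) + 3 * (y / wallRate y ^ 8)) := by ring
  rw [e]
  linarith

end Literature.Probability.RandomPlanarGeometry.SAW.HexBW.Wall
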